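import Literature.AlgebraicGeometry.Resolution.ProjectiveModelsDomination
import Literature.AlgebraicGeometry.Motives.CartierDivisor
import HarnessLib

/-!
# The function field of a projective model: `K(M) ≅ K` over `k`, and its functoriality

Topic: `Literature/AlgebraicGeometry/Resolution`. Bookkeeping for the projective models of
`ProjectiveModels.lean` (`ProjModel k K`: an integral projective `k`-scheme `M` with a `K`-point
`gen_M : Spec K → M` hitting the generic point with `𝒪_{M,ξ} ≅ K`; Zariski–Samuel II, Ch. VI
§17: "the models of `K`" share the function field `K`). The rational-map machinery of the tree
(`RationalFunctionsToProjectiveSpace*`, `RationalMapBaseIdeal`) is phrased with Mathlib's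
function field `M.X.functionField = 𝒪_{M,ξ}`, the morphism `Spec K(M) → M`
(`Scheme.fromSpecStalk`), a `k`-algebra structure on `K(M)` and the field maps
`π^♯ : K(M) → K(N)` of dominant morphisms (`Motives.RatFn.functionFieldMap`); this file
identifies all of it with the abstract `K`. All PROVED:

* `hom_ext_of_specMap_comp_fromSpecStalk` — two local homomorphisms `𝒪_{X,x} → R` inducing the
  same morphism `Spec R → Spec 𝒪_{X,x} → X` are equal (Mathlib's `SpecToEquivOfLocalRing` in the
  form needed here);
* `specMap_functionFieldMap_fromSpecStalk` — for a dominant `g : Y → X` of integral schemes,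
  `Spec K(Y) → Spec K(X) → X` is `Spec K(Y) → Y → X`;
* `ProjModel.funFieldIso M : M.X.functionField ≅ K` with
  `specMap_funFieldIso_hom_fromSpecStalk` (`Spec K ≅ Spec K(M) → M` is `gen_M`); the `k`-algebra
  structure `ProjModel.algebraFunctionField` on `K(M)` transported from `K`, for which
  `funFieldIso` is a `k`-algebra isomorphism (`funFieldAlgEquiv`) and
  `fromSpecStalk_genericPoint_π` holds (`Spec K(M) → M → Spec k` is `Spec` of the structure map —
  the hypothesis `hgen` of `fromSpecStalk_genericPoint_toProjOfVec`);
* `ProjModel.Hom.isDominant`, **`functionFieldMap_comp_funFieldIso`** — for a morphism of models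
  `φ : N → M`, `φ^♯ : K(M) → K(N)` is compatible with the identifications with `K` (so it is THE
  identity of `K`: `funFieldIso_hom_functionFieldMap`), hence `k`-linear
  (`Hom.functionFieldAlgHom`).

## References

* O. Zariski, P. Samuel, *Commutative Algebra* II, Ch. VI §17. [ZariskiSamuel1960]
* O. Piltant, RACSAM 107 (2013), §2. [Piltant2013]
-/

noncomputable section

open CategoryTheory AlgebraicGeometry TopologicalSpace IsLocalRing
open Literature.AlgebraicGeometry.Motives

namespace Literature.AlgebraicGeometry.Resolution

universe u

/-! ## Two lemmas on `Spec 𝒪_{X,x} → X` -/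

/-- A ring homomorphism out of a field into a non-trivial ring is a local homomorphism.
[folklore] -/
theorem isLocalHom_of_field {F R : Type*} [Field F] [CommRing R] [Nontrivial R] (f : F →+* R) :
    IsLocalHom f := by
  refine ⟨fun a ha => ?_⟩
  rcases eq_or_ne a 0 with rfl | h
  · rw [map_zero] at ha
    exact absurd ha not_isUnit_zero
  · exact isUnit_iff_ne_zero.mpr h

/-- **Two local homomorphisms `u, v : 𝒪_{X,x} → R` with `Spec u ≫ (Spec 𝒪_{X,x} → X) =
Spec v ≫ (Spec 𝒪_{X,x} → X)` are equal** (the injectivity half of Mathlib's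
`SpecToEquivOfLocalRing`: a morphism `Spec R → X` from a local scheme determines the local
homomorphism on the stalk, `Scheme.germ_stalkClosedPointTo_Spec_fromSpecStalk`). [folklore] -/
theorem hom_ext_of_specMap_comp_fromSpecStalk {X : Scheme.{u}} {x : X} {R : CommRingCat.{u}}
    [IsLocalRing R] (u v : X.presheaf.stalk x ⟶ R) [IsLocalHom u.hom] [IsLocalHom v.hom]
    (h : Spec.map u ≫ X.fromSpecStalk x = Spec.map v ≫ X.fromSpecStalk x) : u = v := by
  apply TopCat.Presheaf.stalk_hom_ext
  intro U hxU
  have hu : (Spec.map u ≫ X.fromSpecStalk x) (closedPoint R) ∈ U := by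
    rwa [Scheme.Hom.comp_apply, Spec_closedPoint, Scheme.fromSpecStalk_closedPoint]
  have hv : (Spec.map v ≫ X.fromSpecStalk x) (closedPoint R) ∈ U := by
    rwa [Scheme.Hom.comp_apply, Spec_closedPoint, Scheme.fromSpecStalk_closedPoint]
  have key : ∀ (f g : Spec R ⟶ X) (_ : f = g) (hf : f (closedPoint R) ∈ U)
      (hg : g (closedPoint R) ∈ U),
      X.presheaf.germ U _ hf ≫ Scheme.stalkClosedPointTo f =
        X.presheaf.germ U _ hg ≫ Scheme.stalkClosedPointTo g := by
    rintro f g rfl _ _; rfl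
  have := key _ _ h hu hv
  rwa [Scheme.germ_stalkClosedPointTo_Spec_fromSpecStalk u U hu,
    Scheme.germ_stalkClosedPointTo_Spec_fromSpecStalk v U hv] at this

/-- **`Spec K(Y) → Spec K(X) → X` is `Spec K(Y) → Y → X`** for a dominant morphism `g : Y → X` of
integral schemes and the field map `g^♯ : K(X) → K(Y)` (`Motives.RatFn.functionFieldMap`).
[folklore] -/
@[reassoc]
theorem specMap_functionFieldMap_fromSpecStalk {X Y : Scheme.{u}} [IsIntegral X] [IsIntegral Y]
    (g : Y ⟶ X) [IsDominant g] :
    Spec.map (CommRingCat.ofHom (RatFn.functionFieldMap g)) ≫ X.fromSpecStalk (genericPoint X) =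
      Y.fromSpecStalk (genericPoint Y) ≫ g := by
  rw [show CommRingCat.ofHom (RatFn.functionFieldMap g) =
      X.presheaf.stalkSpecializes (RatFn.specializes_genericPoint g) ≫
        g.stalkMap (genericPoint Y) from rfl,
    Spec.map_comp, Category.assoc, Scheme.SpecMap_stalkSpecializes_fromSpecStalk,
    Scheme.SpecMap_stalkMap_fromSpecStalk]

namespace ProjModel

variable {k K : Type u} [Field k] [Field K] [Algebra k K]

/-! ## `K(M) ≅ K` -/

/-- **The function field of a projective model is `K`**: the isomorphism
`K(M) = 𝒪_{M,ξ} ≅ 𝒪_{M, gen_M(pt)} ≅ K` (the second map is the stalk map of the `K`-point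
`gen_M`, an isomorphism by definition of a model). [cite: ZariskiSamuel1960, Ch. VI §17] -/
def funFieldIso (M : ProjModel k K) : M.X.functionField ≅ CommRingCat.of K :=
  M.X.presheaf.stalkCongr (Inseparable.of_eq M.genericPt_eq.symm) ≪≫
    asIso (Scheme.stalkClosedPointTo M.gen)

/-- **`Spec K ≅ Spec K(M) → M` is the `K`-point `gen_M`.** [cite: ZariskiSamuel1960, Ch. VI §17] -/
@[reassoc (attr := simp)]
theorem specMap_funFieldIso_hom_fromSpecStalk (M : ProjModel k K) :
    Spec.map M.funFieldIso.hom ≫ M.X.fromSpecStalk (genericPoint M.X) = M.gen := by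
  rw [funFieldIso, Iso.trans_hom, Spec.map_comp, Category.assoc, TopCat.Presheaf.stalkCongr_hom,
    Scheme.SpecMap_stalkSpecializes_fromSpecStalk, asIso_hom,
    Scheme.Spec_stalkClosedPointTo_fromSpecStalk]

/-- `Spec K(M) → M` is `Spec K(M) ≅ Spec K → M` (`gen_M`). [folklore] -/
theorem fromSpecStalk_genericPoint_eq (M : ProjModel k K) :
    M.X.fromSpecStalk (genericPoint M.X) = Spec.map M.funFieldIso.inv ≫ M.gen := by
  rw [← specMap_funFieldIso_hom_fromSpecStalk, ← Spec.map_comp_assoc, Iso.hom_inv_id,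
    Spec.map_id, Category.id_comp]

/-- **The `k`-algebra structure on `K(M)`** transported from `K` along `K(M) ≅ K`. [folklore] -/
instance algebraFunctionField (M : ProjModel k K) : Algebra k M.X.functionField :=
  (M.funFieldIso.inv.hom.comp (algebraMap k K)).toAlgebra

/-- Unfolding the `k`-algebra structure on `K(M)`. [folklore] -/
theorem algebraMap_functionField (M : ProjModel k K) :
    algebraMap k M.X.functionField = M.funFieldIso.inv.hom.comp (algebraMap k K) := rfl

/-- `K ≅ K(M)` maps `algebraMap k K c` to `algebraMap k K(M) c`. [folklore] -/
@[simp] theorem funFieldIso_inv_algebraMap (M : ProjModel k K) (c : k) :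
    M.funFieldIso.inv.hom (algebraMap k K c) = algebraMap k M.X.functionField c := rfl

/-- `K(M) ≅ K` maps `algebraMap k K(M) c` to `algebraMap k K c`. [folklore] -/
@[simp] theorem funFieldIso_hom_algebraMap (M : ProjModel k K) (c : k) :
    M.funFieldIso.hom.hom (algebraMap k M.X.functionField c) = algebraMap k K c := by
  rw [← funFieldIso_inv_algebraMap, ← CommRingCat.comp_apply, Iso.inv_hom_id, CommRingCat.id_apply]

/-- **`K(M) ≅ K` as a `k`-algebra isomorphism.** [cite: ZariskiSamuel1960, Ch. VI §17] -/
def funFieldAlgEquiv (M : ProjModel k K) : M.X.functionField ≃ₐ[k] K :=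
  { M.funFieldIso.commRingCatIsoToRingEquiv with
    commutes' := fun c => M.funFieldIso_hom_algebraMap c }

/-- Unfolding. [folklore] -/
@[simp] theorem funFieldAlgEquiv_apply (M : ProjModel k K) (a : M.X.functionField) :
    M.funFieldAlgEquiv a = M.funFieldIso.hom.hom a := rfl

/-- Unfolding. [folklore] -/
@[simp] theorem funFieldAlgEquiv_symm_apply (M : ProjModel k K) (b : K) :
    M.funFieldAlgEquiv.symm b = M.funFieldIso.inv.hom b := rfl

/-- **`Spec K(M) → M → Spec k` is `Spec` of the structure map `k → K(M)`** (the hypothesis `hgen`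
of `fromSpecStalk_genericPoint_toProjOfVec` for projective models). [folklore] -/
theorem fromSpecStalk_genericPoint_π (M : ProjModel k K) :
    M.X.fromSpecStalk (genericPoint M.X) ≫ M.π =
      Spec.map (CommRingCat.ofHom (algebraMap k M.X.functionField)) := by
  rw [fromSpecStalk_genericPoint_eq, Category.assoc, M.gen_π, ← Spec.map_comp,
    algebraMap_functionField]
  rfl

/-! ## Functoriality along morphisms of models -/

/-- A morphism of projective models is dominant (its image contains the generic point).
[folklore] -/
instance Hom.isDominant {N M : ProjModel k K} (φ : N.Hom M) : IsDominant φ.f :=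
  isDominant_of_comp_eq_gen φ.f N.gen φ.gen_f

/-- Local-homomorphism instances for maps out of the function field. [folklore] -/
instance isLocalHom_funFieldIso_hom (M : ProjModel k K) : IsLocalHom M.funFieldIso.hom.hom :=
  isLocalHom_of_field _

/-- **The field map of a morphism of models is compatible with the identifications with `K`**:
for `φ : N → M`, `(φ^♯ : K(M) → K(N)) ≫ (K(N) ≅ K) = (K(M) ≅ K)` — both sides induce the
`K`-point `gen_M` (`gen_N ≫ φ = gen_M`). [cite: ZariskiSamuel1960, Ch. VI §17] -/
theorem functionFieldMap_comp_funFieldIso {N M : ProjModel k K} (φ : N.Hom M) :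
    CommRingCat.ofHom (RatFn.functionFieldMap φ.f) ≫ N.funFieldIso.hom = M.funFieldIso.hom := by
  haveI : IsLocalHom (CommRingCat.ofHom (RatFn.functionFieldMap φ.f) ≫ N.funFieldIso.hom).hom :=
    isLocalHom_of_field _
  apply hom_ext_of_specMap_comp_fromSpecStalk
  rw [Spec.map_comp, Category.assoc, specMap_functionFieldMap_fromSpecStalk,
    specMap_funFieldIso_hom_fromSpecStalk_assoc, φ.gen_f, specMap_funFieldIso_hom_fromSpecStalk]

/-- Pointwise form: `(K(N) ≅ K) (φ^♯ a) = (K(M) ≅ K) a`. [folklore] -/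
@[simp] theorem funFieldIso_hom_functionFieldMap {N M : ProjModel k K} (φ : N.Hom M)
    (a : M.X.functionField) :
    N.funFieldIso.hom.hom (RatFn.functionFieldMap φ.f a) = M.funFieldIso.hom.hom a := by
  rw [← functionFieldMap_comp_funFieldIso φ]; rfl

/-- Pointwise form with the inverses: `φ^♯ ((K ≅ K(M)) b) = (K ≅ K(N)) b`. [folklore] -/
@[simp] theorem functionFieldMap_funFieldIso_inv {N M : ProjModel k K} (φ : N.Hom M) (b : K) :
    RatFn.functionFieldMap φ.f (M.funFieldIso.inv.hom b) = N.funFieldIso.inv.hom b := by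
  apply N.funFieldIso.commRingCatIsoToRingEquiv.injective
  change N.funFieldIso.hom.hom _ = N.funFieldIso.hom.hom _
  rw [funFieldIso_hom_functionFieldMap, ← CommRingCat.comp_apply, ← CommRingCat.comp_apply,
    Iso.inv_hom_id, Iso.inv_hom_id]

/-- The field map of a morphism of models is `k`-linear. [folklore] -/
theorem functionFieldMap_algebraMap {N M : ProjModel k K} (φ : N.Hom M) (c : k) :
    RatFn.functionFieldMap φ.f (algebraMap k M.X.functionField c) =
      algebraMap k N.X.functionField c := by
  rw [← funFieldIso_inv_algebraMap, functionFieldMap_funFieldIso_inv, funFieldIso_inv_algebraMap]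

/-- **The field map `φ^♯ : K(M) → K(N)` of a morphism of models as a `k`-algebra map.**
[cite: ZariskiSamuel1960, Ch. VI §17] -/
def Hom.functionFieldAlgHom {N M : ProjModel k K} (φ : N.Hom M) :
    M.X.functionField →ₐ[k] N.X.functionField :=
  { RatFn.functionFieldMap φ.f with commutes' := functionFieldMap_algebraMap φ }

/-- Unfolding. [folklore] -/
@[simp] theorem Hom.functionFieldAlgHom_apply {N M : ProjModel k K} (φ : N.Hom M)
    (a : M.X.functionField) : φ.functionFieldAlgHom a = RatFn.functionFieldMap φ.f a := rfl

/-- `φ^♯` is `(K ≅ K(N)) ∘ (K(M) ≅ K)`: in terms of `K` it is the identity. [folklore] -/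
theorem Hom.functionFieldAlgHom_apply_eq {N M : ProjModel k K} (φ : N.Hom M)
    (a : M.X.functionField) :
    φ.functionFieldAlgHom a = N.funFieldAlgEquiv.symm (M.funFieldAlgEquiv a) := by
  change RatFn.functionFieldMap φ.f a = N.funFieldIso.inv.hom (M.funFieldIso.hom.hom a)
  rw [← functionFieldMap_funFieldIso_inv φ, ← CommRingCat.comp_apply, Iso.hom_inv_id,
    CommRingCat.id_apply]

end ProjModel

end Literature.AlgebraicGeometry.Resolution

end
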